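import Summits.CriticalPhenomena.PercolationContinuityZ3.Theses.PercDivergentSlabLadder
import Summits.CriticalPhenomena.PercolationContinuityZ3.Theses.PercAnnulusCrossing
import Summits.CriticalPhenomena.PercolationContinuityZ3.Theorems.PercTiltedBlockersAnnulusAssembly
import Summits.CriticalPhenomena.PercolationContinuityZ3.Theorems.PercTiltedBlockersCrossingTendstoOne
import Summits.CriticalPhenomena.PercolationContinuityZ3.Cruxes.ConeRung.Lines.birth
import Literature.Probability.Percolation.SubgraphMonotonicity
import Literature.Probability.Percolation.ConnectivityProofs
import Literature.Probability.Percolation.BondPercolationSymmetry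
import Literature.Probability.Percolation.SiteConnectionTools
import Literature.Probability.Percolation.LatticeSymmetry
import Literature.Probability.Percolation.PlanarDuality
import Literature.Probability.Percolation.InequalitiesProofs
import Literature.Probability.Percolation.Crossings
import Literature.Probability.Percolation.HalfSpacePinnedPairs
import Literature.Probability.Percolation.SharpnessDCTProofs
import Literature.Probability.Percolation.RSW

/-!
# `ConeRung` (stmt-CriticalPhenomena-6701) — the costume theorems (crux-strategist r1, 2026-08-17)

Route `route-CriticalPhenomena-PercDivergentSlabLadder`, deciding crux
`ConeRung : ∀ m, ∀ x ∈ V_m = {|z₀| ≤ m·max(|z₁|,|z₂|)}, θ_{ℤ³[V_m]}(x, p_c(ℤ³)) = 0`.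
The route was flagged `smuggling; attack=2`. This file banks, KERNEL-CHECKED and sorry-free
(the only `sorry`s in the import closure are the three registered stubs of `Lines/birth.lean`,
none of which is used below), the four facts behind the strategist's verdict
`no-strategy` (see `STRATEGY-CENSUS.md` next to this file):

1. `coneRung_of_summit` — **S → C**: the crux is a CONSEQUENCE of the conjunct
   (`θ_{ℤ³[V_m]}(x) ≤ θ_{ℤ³}(x) = θ_{ℤ³}(0) = 0`; `theta_induce_le_holds`,
   `theta_zdGraph_eq_theta_zero`).
2. `lineConeRemoval_iff` — the route's only consumer of the crux, `LineConeRemoval`, is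
   LITERALLY `ConeRung → S` (so `closes` is `C ∧ (C → S)`; all same-`p` content sits in the
   converse, which has no mechanism: the judge's "smuggling").
3. `coneRung_iff_tail` — the crux does not split by aperture: for every `m₀`,
   `ConeRung ↔ ∀ m ≥ m₀, ConeRung m` (`V_m ⊆ V_{m'}` for `m ≤ m'`, `theta_induce_mono_holds`), so
   the decidable instance `m = 0` (the plane at `p_c(ℤ³) < 1/2`) carries no weight and every
   honest piece is the `m → ∞` tail, i.e. the crux itself.
4. `summit_of_washerCrossingAllAspects` — the ONLY open stub of the ONLY registered line
   (`Lines/birth.lean`, `stub_washerCrossingAllAspects` = the route's foreseen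
   `FlatAnnulusCrossingAll`) implies the conjunct BY ITSELF, without passing through the crux:
   `WasherCrossingAllAspects → CritAnnulusNonCrossing` (= `X_B`, crux r2 of route
   PercAnnulusCrossing; proof: aspect `m = 2`, the three coordinate images of the washer bound
   (`bondPercolation_real_preimage_relabel_iso`), Harris–FKG for the three decreasing
   non-crossing events (`harris_fkg_lower`), and the deterministic fact that an open crossing of
   the shell `B(2n) ∖ B(n)` crosses one of the three axis-washers of aspect `2` radially —
   `exists_washerCrossingAt`), and `X_B → S` is PROVED in the tree
   (`percAnnulusCrossing_assembly_proof`, `crossingTendstoOne_annulus_proof`). Hence the line's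
   load-bearing hypothesis DOMINATES the summit (tribunal T1: "a dominating hypothesis H ⇒ C
   with H ⇒ S alone"), and the decomposition `ConeRung ⇐ FlatAnnulusCrossingAll + glue` of the
   route header has a piece giving `S` on its own.

Nothing here restates or weakens the crux; the crux decl is used BY NAME throughout.
-/

noncomputable section

namespace Summit.CriticalPhenomena.PercolationContinuityZ3.Cruxes.ConeRung.Costume

open MeasureTheory Filter Literature.Probability.Percolation Literature.Probability.LatticeModels
open Summit.CriticalPhenomena.PercolationContinuityZ3.Theses.PercDivergentSlabLadder
  (ConeRung LineConeRemoval)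
open Summit.CriticalPhenomena.PercolationContinuityZ3.Theses.PercAnnulusCrossing
  (CritAnnulusNonCrossing)
open Summit.CriticalPhenomena.PercolationContinuityZ3.Cruxes.ConeRung.Birth
  (μc cone washer washerCrossing WasherCrossingAllAspects theta_cone_nonneg)

/-! ## 1. `S → C`: the crux is a consequence of the conjunct -/

/-- **`S → ConeRung`.** `θ(p_c) = 0` on `ℤ³` implies `θ = 0` at `p_c(ℤ³)` at every vertex of every
induced subgraph, in particular of every cone complement `V_m`. -/
theorem coneRung_of_summit (hS : _root_.PercolationContinuityZ3) : ConeRung := by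
  intro m x
  have h0 : theta (zdGraph 3) (0 : Site 3) (criticalProbI 3) = 0 :=
    Literature.Probability.Percolation.percolationContinuityZ3_iff.1 hS
  have h1 : theta ((zdGraph 3).induce (cone m)) x (criticalProbI 3) ≤
      theta (zdGraph 3) (x : Site 3) (criticalProbI 3) :=
    theta_induce_le_holds (zdGraph 3) (cone m) (x : Site 3) x.2 (criticalProbI 3)
  rw [theta_zdGraph_eq_theta_zero, h0] at h1
  exact le_antisymm h1 (theta_cone_nonneg m x)

/-! ## 2. The bridge is the converse, verbatim -/

/-- **`LineConeRemoval ↔ (ConeRung → S)`**: the route's same-`p` bridge is literally the statement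
that the crux implies the conjunct (pure logic plus `θ ≥ 0`). -/
theorem lineConeRemoval_iff : LineConeRemoval ↔ (ConeRung → _root_.PercolationContinuityZ3) := by
  constructor
  · intro hL hC
    refine Literature.Probability.Percolation.percolationContinuityZ3_iff.2
      (le_antisymm (not_lt.1 fun hθ => ?_) measureReal_nonneg)
    obtain ⟨m, x, hx⟩ := hL hθ
    exact absurd (hC m x) (ne_of_gt hx)
  · intro h hθ
    by_contra hne
    push Not at hne
    have hC : ConeRung := fun m x => le_antisymm (hne m x) (theta_cone_nonneg m x)
    have h0 : theta (zdGraph 3) (0 : Site 3) (criticalProbI 3) = 0 :=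
      Literature.Probability.Percolation.percolationContinuityZ3_iff.1 (h hC)
    exact absurd h0 (ne_of_gt hθ)

/-! ## 3. No split by aperture: the crux is its own tail -/

/-- `V_m ⊆ V_{m'}` for `m ≤ m'`. -/
theorem cone_mono {m m' : ℕ} (h : m ≤ m') : cone m ⊆ cone m' := by
  intro z hz
  simp only [Set.mem_setOf_eq] at hz ⊢
  have hρ : 0 ≤ max |z 1| |z 2| := le_trans (abs_nonneg _) (le_max_left _ _)
  calc |z 0| ≤ (m : ℤ) * max |z 1| |z 2| := hz
    _ ≤ (m' : ℤ) * max |z 1| |z 2| := by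
        apply mul_le_mul_of_nonneg_right _ hρ
        exact_mod_cast h

/-- **`ConeRung ↔ its tail`**: for every `m₀`, the crux is equivalent to its restriction to
apertures `m ≥ m₀` (antitonicity in `m`). In particular the decidable instance `m = 0` (the
coordinate plane at `p_c(ℤ³) < 1/2`) is weightless: no split of the crux by `m` has two honest
pieces. -/
theorem coneRung_iff_tail (m₀ : ℕ) :
    ConeRung ↔ ∀ m : ℕ, m₀ ≤ m → ∀ x : ↥(cone m),
      theta ((zdGraph 3).induce (cone m)) x (criticalProbI 3) = 0 := by
  constructor
  · intro h m _ x
    exact h m x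
  · intro h m x
    have hsub : cone m ⊆ cone (max m m₀) := cone_mono (le_max_left _ _)
    have h1 : theta ((zdGraph 3).induce (cone m)) x (criticalProbI 3) ≤
        theta ((zdGraph 3).induce (cone (max m m₀))) ⟨(x : Site 3), hsub x.2⟩ (criticalProbI 3) :=
      theta_induce_mono_holds (zdGraph 3) hsub (x : Site 3) x.2 (criticalProbI 3)
    rw [h (max m m₀) (le_max_right _ _)] at h1
    exact le_antisymm h1 (theta_cone_nonneg m x)

/-! ## 4. The registered line's only open stub gives the summit by itself -/

section WasherToAnnulus

/-- Lateral radius about the axis `a`: `ρ_a(z) = max(|z_j|, |z_k|)` over the two other coordinates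
(written with `swap 0 a` so that `ρ_a = ρ ∘ axisPerm a` is a `simp` fact). -/
def rhoAt (a : Fin 3) (z : Site 3) : ℤ :=
  max |z (Equiv.swap (0 : Fin 3) a 1)| |z (Equiv.swap (0 : Fin 3) a 2)|

/-- The lattice symmetry exchanging the axes `0` and `a`. -/
def axisPerm (a : Fin 3) : Site 3 ≃ Site 3 := Site.signedPerm (Equiv.swap (0 : Fin 3) a) 1

theorem axisPerm_apply (a : Fin 3) (z : Site 3) (i : Fin 3) :
    axisPerm a z i = z (Equiv.swap (0 : Fin 3) a i) := by
  simp [axisPerm, Site.signedPerm_apply, Equiv.symm_swap]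

theorem rho_axisPerm (a : Fin 3) (z : Site 3) :
    max |axisPerm a z 1| |axisPerm a z 2| = rhoAt a z := by
  rw [axisPerm_apply, axisPerm_apply, rhoAt]

theorem axisPerm_zero (a : Fin 3) (z : Site 3) : axisPerm a z 0 = z a := by
  rw [axisPerm_apply, Equiv.swap_apply_left]

/-- The washer-crossing event about the axis `a` (aspect `m`, scale `R`): the coordinate image of
the birth line's `washerCrossing m R`. -/
def washerCrossingAt (a : Fin 3) (m R : ℕ) : Set (BondConfig (Site 3)) :=
  ⇑(BondConfig.relabel (sym2Equiv (axisPerm a))) ⁻¹' washerCrossing m R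

/-- Lattice symmetry: every axis-washer is crossed with the same probability. -/
theorem real_washerCrossingAt (a : Fin 3) (m R : ℕ) :
    μc.real (washerCrossingAt a m R) = μc.real (washerCrossing m R) :=
  bondPercolation_real_preimage_relabel_iso (zdSignedPermIso (Equiv.swap (0 : Fin 3) a) 1)
    (criticalProbI 3) (washerCrossing m R)

theorem isUpperSet_washerCrossing (m R : ℕ) : IsUpperSet (washerCrossing m R) := by
  rintro ω ω' hle ⟨x, y, hx, hy, hω⟩
  exact ⟨x, y, hx, hy, isUpperSet_openConnIn _ x y hle hω⟩

theorem measurableSet_washerCrossing (m R : ℕ) : MeasurableSet (washerCrossing m R) := by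
  have h : washerCrossing m R = ⋃ x : Site 3, ⋃ y : Site 3,
      ({ω | max |x 1| |x 2| = (R : ℤ) ∧ max |y 1| |y 2| = 2 * (R : ℤ)} ∩
        openConnIn (washer m R) x y) := by
    ext ω
    simp only [washerCrossing, Set.mem_iUnion, Set.mem_inter_iff, Set.mem_setOf_eq]
    constructor
    · rintro ⟨x, y, hx, hy, h⟩
      exact ⟨x, y, ⟨hx, hy⟩, h⟩
    · rintro ⟨x, y, ⟨hx, hy⟩, h⟩
      exact ⟨x, y, hx, hy, h⟩
  rw [h]
  exact MeasurableSet.iUnion fun x => MeasurableSet.iUnion fun y =>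
    (MeasurableSet.const _).inter (measurableSet_openConnIn_of_countable _ x y)

theorem isUpperSet_washerCrossingAt (a : Fin 3) (m R : ℕ) : IsUpperSet (washerCrossingAt a m R) :=
  (isUpperSet_washerCrossing m R).preimage_relabel _

theorem measurableSet_washerCrossingAt (a : Fin 3) (m R : ℕ) :
    MeasurableSet (washerCrossingAt a m R) :=
  (BondConfig.relabel (sym2Equiv (axisPerm a))).measurable (measurableSet_washerCrossing m R)

/-- **Level-crossing surgery.** Along an open walk inside `S` of a graph on which `f` drops by at
most `1` per step, from a vertex with `f ≥ n` to a vertex with `f ≤ n`, the initial segment up to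
the first vertex with `f = n` is an open path inside `S ∩ {f ≥ n}`. -/
theorem exists_level_crossing {V : Type*} {G : SimpleGraph V} {ω : BondConfig V} {S : Set V}
    (f : V → ℤ) (hf : ∀ z w, G.Adj z w → f z ≤ f w + 1) (n : ℤ) :
    ∀ {v u : V} (q : G.Walk v u), (∀ z ∈ q.support, z ∈ S) → (∀ e ∈ q.edges, e ∈ ω) →
      n ≤ f v → f u ≤ n → ∃ u', f u' = n ∧ ω ∈ openConnIn (S ∩ {z | n ≤ f z}) v u' := by
  intro v u q
  induction q with
  | nil =>
    intro hS _ hv hu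
    exact ⟨_, le_antisymm hu hv, openConnIn_refl ⟨hS _ (by simp), hv⟩⟩
  | @cons a c _ hac q ih =>
    intro hS hω ha hu
    by_cases h : f a = n
    · exact ⟨a, h, openConnIn_refl ⟨hS a (by simp), ha⟩⟩
    · have hc : n ≤ f c := by
        have := hf a c hac
        omega
      obtain ⟨u', hu', hcu'⟩ :=
        ih (fun z hz => hS z (by simp [hz])) (fun e he => hω e (by simp [he])) hc hu
      exact ⟨u', hu', PlanarDuality.openConnIn_trans
        (openConnIn_of_adj ⟨hS a (by simp), ha⟩ ⟨hS c (by simp), hc⟩ (hω _ (by simp)) hac.ne)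
        hcu'⟩

theorem abs_le_of_mem_box {L : ℕ} {z : Site 3} (hz : z ∈ box 3 L) (i : Fin 3) : |z i| ≤ L := by
  rw [mem_box] at hz
  exact abs_le.2 ⟨(hz i).1, (hz i).2⟩

theorem rhoAt_le_of_mem_box {L : ℕ} {z : Site 3} (hz : z ∈ box 3 L) (a : Fin 3) :
    rhoAt a z ≤ L :=
  max_le (abs_le_of_mem_box hz _) (abs_le_of_mem_box hz _)

/-- `ρ_a` drops by at most `1` along a lattice bond. -/
theorem rhoAt_le_rhoAt_add_one {z w : Site 3} (h : (zdGraph 3).Adj z w) (a : Fin 3) :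
    rhoAt a z ≤ rhoAt a w + 1 := by
  have h1 := DCT16.abs_sub_le_one_of_adj h (Equiv.swap (0 : Fin 3) a 1)
  have h2 := DCT16.abs_sub_le_one_of_adj h (Equiv.swap (0 : Fin 3) a 2)
  have e1 := (abs_sub_abs_le_abs_sub (z (Equiv.swap (0 : Fin 3) a 1))
    (w (Equiv.swap (0 : Fin 3) a 1))).trans h1
  have e2 := (abs_sub_abs_le_abs_sub (z (Equiv.swap (0 : Fin 3) a 2))
    (w (Equiv.swap (0 : Fin 3) a 2))).trans h2
  unfold rhoAt
  rcases le_total |w (Equiv.swap (0 : Fin 3) a 1)| |w (Equiv.swap (0 : Fin 3) a 2)| with hw | hw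
  · rw [max_eq_right hw]
    exact max_le (by linarith) (by linarith)
  · rw [max_eq_left hw]
    exact max_le (by linarith) (by linarith)

/-- **The deterministic step.** For a lattice configuration `ω ⊆ E(ℤ³)` and `n ≥ 1`, an open path
inside `B(2n)` from `B(n)` to `∂ⁱⁿB(2n)` crosses radially, inside itself, the axis-washer
`{|z_a| ≤ 2n, n ≤ ρ_a ≤ 2n}` of aspect `2` about some axis `a` — namely any axis `a ≠ i`, where
`|y_i| = 2n` at the endpoint: the final segment after the last visit to `{ρ_a ≤ n}`. -/
theorem mem_washerCrossingAt_of_crossing {n : ℕ} {ω : BondConfig (Site 3)}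
    (hω : ω ⊆ (zdGraph 3).edgeSet) {x y : Site 3} (hx : x ∈ box 3 n)
    (hy : y ∈ box 3 (2 * n)) {i : Fin 3} (hyi : |y i| = 2 * (n : ℤ))
    (hxy : ω ∈ openConnIn (↑(box 3 (2 * n)) : Set (Site 3)) x y) {a : Fin 3}
    (ha : Equiv.swap (0 : Fin 3) a 1 = i ∨ Equiv.swap (0 : Fin 3) a 2 = i) :
    ω ∈ washerCrossingAt a 2 n := by
  -- `ρ_a(y) = 2n`, `ρ_a(x) ≤ n`
  have hρy : rhoAt a y = 2 * (n : ℤ) := by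
    apply le_antisymm
    · have := rhoAt_le_of_mem_box hy a
      push_cast at this
      exact this
    · rcases ha with h | h
      · calc 2 * (n : ℤ) = |y i| := hyi.symm
          _ = |y (Equiv.swap (0 : Fin 3) a 1)| := by rw [h]
          _ ≤ rhoAt a y := le_max_left _ _
      · calc 2 * (n : ℤ) = |y i| := hyi.symm
          _ = |y (Equiv.swap (0 : Fin 3) a 2)| := by rw [h]
          _ ≤ rhoAt a y := le_max_right _ _
  have hρx : rhoAt a x ≤ (n : ℤ) := rhoAt_le_of_mem_box hx a
  -- an open lattice walk from `y` back to `x` inside `B(2n)`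
  have hyx : ω ∈ openConnIn (↑(box 3 (2 * n)) : Set (Site 3)) y x := by
    obtain ⟨hx', hy', hr⟩ := hxy
    exact ⟨hy', hx', hr.symm⟩
  obtain ⟨q, hqS, hqω⟩ := exists_walk_of_mem_openConnIn hω hyx
  -- stop at the first vertex with `ρ_a = n`
  obtain ⟨u', hu', hyu'⟩ := exists_level_crossing (G := zdGraph 3) (rhoAt a)
    (fun z w h => rhoAt_le_rhoAt_add_one h a) (n : ℤ) q hqS hqω (by rw [hρy]; omega) hρx
  -- read it in the coordinates of the birth line's washer about the axis `0`
  have h1 : ω ∈ openConnIn ((↑(box 3 (2 * n)) : Set (Site 3)) ∩ {z | (n : ℤ) ≤ rhoAt a z}) u' y := by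
    obtain ⟨hy', hu'', hr⟩ := hyu'
    exact ⟨hu'', hy', hr.symm⟩
  have h2 := relabel_mem_openConnIn (axisPerm a) h1
  show BondConfig.relabel (sym2Equiv (axisPerm a)) ω ∈ washerCrossing 2 n
  refine ⟨axisPerm a u', axisPerm a y, ?_, ?_, openConnIn_mono ?_ _ _ h2⟩
  · rw [rho_axisPerm, hu']
  · rw [rho_axisPerm, hρy]
  · rintro _ ⟨z, ⟨hzB, hzρ⟩, rfl⟩
    have hzB' : z ∈ box 3 (2 * n) := Finset.mem_coe.1 hzB
    refine ⟨?_, ?_, ?_⟩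
    · rw [axisPerm_zero]
      have := abs_le_of_mem_box hzB' a
      push_cast at this ⊢
      linarith
    · rw [rho_axisPerm]
      exact hzρ
    · rw [rho_axisPerm]
      have := rhoAt_le_of_mem_box hzB' a
      push_cast at this
      exact this

/-- The three axis-washers cover every crossing of the shell (for `ω ⊆ E(ℤ³)`, `n ≥ 1`). -/
theorem exists_washerCrossingAt {n : ℕ} {ω : BondConfig (Site 3)}
    (hω : ω ⊆ (zdGraph 3).edgeSet) {x y : Site 3} (hx : x ∈ box 3 n)
    (hy : y ∈ innerBoundary (zdGraph 3) (box 3 (2 * n)))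
    (hxy : ω ∈ openConnIn (↑(box 3 (2 * n)) : Set (Site 3)) x y) :
    ω ∈ washerCrossingAt 0 2 n ∨ ω ∈ washerCrossingAt 1 2 n ∨ ω ∈ washerCrossingAt 2 2 n := by
  have hyB : y ∈ box 3 (2 * n) := (mem_innerBoundary_iff.1 hy).1
  obtain ⟨i, hi⟩ := exists_eq_of_mem_innerBoundary_box hy
  have hyi : |y i| = 2 * (n : ℤ) := by
    rcases hi with h | h <;> rw [h] <;> push_cast <;> simp [abs_of_nonneg]
  fin_cases i
  · -- `|y 0| = 2n`: use the washer about the axis `1` (`swap 0 1 1 = 0`)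
    exact Or.inr (Or.inl (mem_washerCrossingAt_of_crossing hω hx hyB hyi hxy (Or.inl (by decide))))
  · -- `|y 1| = 2n`: the washer about the axis `0`
    exact Or.inl (mem_washerCrossingAt_of_crossing hω hx hyB hyi hxy (Or.inl (by decide)))
  · -- `|y 2| = 2n`: the washer about the axis `0`
    exact Or.inl (mem_washerCrossingAt_of_crossing hω hx hyB hyi hxy (Or.inr (by decide)))

/-- **`WasherCrossingAllAspects → X_B`.** The all-aspect flat-washer RSW bound of the birth line
(used at the single aspect `m = 2`) implies the bulk annulus non-crossing bound
`CritAnnulusNonCrossing` of route PercAnnulusCrossing, with constant `c³`. -/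
theorem critAnnulusNonCrossing_of_washerCrossingAllAspects (hW : WasherCrossingAllAspects) :
    CritAnnulusNonCrossing := by
  obtain ⟨c, hc, hR⟩ := hW 2
  refine ⟨c ^ 3, by positivity, fun n hn => ?_⟩
  -- the three decreasing non-crossing events and their Harris–FKG lower bound
  have hEm : ∀ a : Fin 3, MeasurableSet (washerCrossingAt a 2 n) :=
    fun a => measurableSet_washerCrossingAt a 2 n
  have hEl : ∀ a : Fin 3, IsLowerSet (washerCrossingAt a 2 n)ᶜ :=
    fun a => (isUpperSet_washerCrossingAt a 2 n).compl
  have hEc : ∀ a : Fin 3, c ≤ μc.real (washerCrossingAt a 2 n)ᶜ := fun a => by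
    rw [probReal_compl_eq_one_sub (hEm a), real_washerCrossingAt]
    have := hR n hn
    linarith
  have h01 : μc.real (washerCrossingAt 0 2 n)ᶜ * μc.real (washerCrossingAt 1 2 n)ᶜ ≤
      μc.real ((washerCrossingAt 0 2 n)ᶜ ∩ (washerCrossingAt 1 2 n)ᶜ) :=
    harris_fkg_lower _ _ (hEl 0) (hEl 1) (hEm 0).compl (hEm 1).compl
  have h012 : μc.real ((washerCrossingAt 0 2 n)ᶜ ∩ (washerCrossingAt 1 2 n)ᶜ) *
        μc.real (washerCrossingAt 2 2 n)ᶜ ≤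
      μc.real ((washerCrossingAt 0 2 n)ᶜ ∩ (washerCrossingAt 1 2 n)ᶜ ∩
        (washerCrossingAt 2 2 n)ᶜ) :=
    harris_fkg_lower _ _ ((hEl 0).inter (hEl 1)) (hEl 2) ((hEm 0).compl.inter (hEm 1).compl)
      (hEm 2).compl
  have hprod : c ^ 3 ≤ μc.real ((washerCrossingAt 0 2 n)ᶜ ∩ (washerCrossingAt 1 2 n)ᶜ ∩
      (washerCrossingAt 2 2 n)ᶜ) := by
    have h0 := hEc 0
    have h1 := hEc 1
    have h2 := hEc 2
    have hc0 : 0 ≤ c := hc.le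
    calc c ^ 3 = c * c * c := by ring
      _ ≤ μc.real (washerCrossingAt 0 2 n)ᶜ * μc.real (washerCrossingAt 1 2 n)ᶜ *
            μc.real (washerCrossingAt 2 2 n)ᶜ := by gcongr
      _ ≤ μc.real ((washerCrossingAt 0 2 n)ᶜ ∩ (washerCrossingAt 1 2 n)ᶜ) *
            μc.real (washerCrossingAt 2 2 n)ᶜ := by gcongr
      _ ≤ _ := h012
  -- the crossing event is a.s. contained in the union of the three washer crossings
  set B : Set (BondConfig (Site 3)) := (washerCrossingAt 0 2 n)ᶜ ∩ (washerCrossingAt 1 2 n)ᶜ ∩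
    (washerCrossingAt 2 2 n)ᶜ with hB
  have hBm : MeasurableSet B := ((hEm 0).compl.inter (hEm 1).compl).inter (hEm 2).compl
  have hae : ∀ᵐ ω ∂μc, ω ⊆ (zdGraph 3).edgeSet := ProbabilityTheory.setBernoulli_ae_subset
  have hAB : μc.real {ω | ∃ x ∈ box 3 n, ∃ y ∈ innerBoundary (zdGraph 3) (box 3 (2 * n)),
      ω ∈ openConnIn (↑(box 3 (2 * n)) : Set (Site 3)) x y} ≤ μc.real Bᶜ := by
    refine ENNReal.toReal_mono (measure_ne_top _ _) (measure_mono_ae ?_)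
    filter_upwards [hae] with ω hω
    rintro ⟨x, hx, y, hy, hxy⟩ ⟨⟨h0, h1⟩, h2⟩
    rcases exists_washerCrossingAt hω hx hy hxy with h | h | h
    · exact h0 h
    · exact h1 h
    · exact h2 h
  rw [probReal_compl_eq_one_sub hBm] at hAB
  linarith

/-- **The registered line's load-bearing stub is summit-sufficient on its own**:
`WasherCrossingAllAspects → θ(p_c) = 0` on `ℤ³`, through `X_B` and the PROVED assembly of
route PercAnnulusCrossing — never touching `ConeRung`. -/
theorem summit_of_washerCrossingAllAspects (hW : WasherCrossingAllAspects) :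
    _root_.PercolationContinuityZ3 :=
  Theorems.percAnnulusCrossing_assembly_proof Theorems.crossingTendstoOne_annulus_proof
    (critAnnulusNonCrossing_of_washerCrossingAllAspects hW)

/-- For the record: the stub therefore also gives the crux, but only THROUGH the summit
(`S → C`, part 1) — the line `birth` is `X_B` in costume. -/
theorem coneRung_of_washerCrossingAllAspects (hW : WasherCrossingAllAspects) : ConeRung :=
  coneRung_of_summit (summit_of_washerCrossingAllAspects hW)

end WasherToAnnulus

end Summit.CriticalPhenomena.PercolationContinuityZ3.Cruxes.ConeRung.Costume

end
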